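import Summits.CriticalPhenomena.PercolationContinuityZ3.Theorems.SahiMasterFamilyMultiCross
import Summits.CriticalPhenomena.PercolationContinuityZ3.Theorems.SahiMasterFamilyLocalToGlobalSix

/-!
# The local-to-global step at EVERY order — hence (TT_k) and the identically-zero master conjecture `MasterFamilyIdentEqIff k` for every `k`

Unit `prim-master-conj` (crux anchor stmt-CriticalPhenomena-4575), gen 12; memo HOME/prim-master-conj/TIGHTNESS-IV.md §5.
Setting `GluedSetting` with a core-free coordinate (glued frames with pairwise disjoint supports, structured contraction faces, structured and
consistent deletion faces); `P` = pure members, `N` = non-pure members.  With (α) and the MULTI-CROSS lemma (`two_le_card_multiCross`):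

* **`goodChain_append_pures`** — for every set `P″ ⊆ P` containing the pure members that fail at all points of a "witness tuple" (`χ z ∈ gann z`,
  `z ∈ Z`), and every list `l` of non-pure members outside `Z` (no repetition), the chain `l ++ P″` (read: the pure members first, then `l` from its
  last element) is GOOD with the glued frames.  Induction on the length: the frame of the new member `y` is its glued frame (multi-cross for
  `Z + y` provides a pure member of `P″` failing at each annihilator point), its annihilator is the glued annihilator, its points fail two members of
  `P″` (multi-cross again), and every robustness set is a sub-list of `l` over a smaller `P‴` with the longer witness tuple `Z + y` — the induction
  hypothesis;
* `structured_pures_union` — `P ∪ N′` is structured for every `N′ ⊆ N` (in particular the whole family: FVT at every order);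
* **`localToGlobal_all : ∀ n, LocalToGlobal n`** — delete a non-pure member (or any member if all are pure);
* **`terminalTight_all : ∀ n, TerminalTight (n + 1)`** and

  **`masterFamilyIdentEqIff_all : ∀ k, MasterFamilyIdentEqIff k`** — THE IDENTICALLY-ZERO MASTER CONJECTURE AT EVERY ORDER: for every `k` and
  all increasing events `U₁,…,U_k` on a finite product of two-point spaces, `E_k(μ_p; 1_{U₁},…,1_{U_k}) = 0` for every `p` in the open cube iff
  `(U₁,…,U_k)` lies in the recursive zero-flag class `Z_k`.

HONEST FRAMING: this is the identically-zero (all interior `p`) form; the pointwise form `MasterFamilyEqIff`, Sahi's `C_k` and Kahn's Conjecture 5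
remain OPEN.  Pure combinatorics on top of gens 2–12; axioms standard. [this work]
-/

noncomputable section

open scoped Classical

namespace Summit.CriticalPhenomena.PercolationContinuityZ3.Theorems

namespace GluedFrames

open Finset Function
open Literature.Probability.LatticeModels.Kahn2022 (Affects)

variable {ι : Type*} [Fintype ι] {κ : Type*} {U : κ → Set (Set ι)} {W : Finset κ}

namespace GluedSetting

variable (G : GluedSetting U W)
include G

/-- **Good chains `(pure members, then non-pure members in any order)` from the multi-cross lemma.**  See the module docstring. [this work] -/
theorem goodChain_append_pures (hE0 : ∃ f, CoreFree U f) :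
    ∀ (m : ℕ) (l : List κ) (Z : Finset κ) (χ : κ → Set ι) (P'' : Finset κ), l.length ≤ m → l.Nodup →
      (∀ y ∈ l, (gann U W y).Nonempty) → (∀ z ∈ Z, χ z ∈ gann U W z) → (∀ y ∈ l, y ∉ Z) →
      P'' ⊆ W.filter (fun p => gann U W p = ∅) →
      (∀ p ∈ W.filter (fun p => gann U W p = ∅), (∀ z ∈ Z, χ z ∉ U p) → p ∈ P'') →
      GoodChain U (l ++ P''.toList) ∧
        frameSupp U (l ++ P''.toList) = (⋃ p ∈ P'', (↑(esupp (U p)) : Set ι)) ∪ ⋃ y ∈ l.toFinset, (↑(esupp (gframe U W y)) : Set ι) := by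
  have hU := G.hU
  have hdP := G.pures_pairwise_disjoint
  intro m
  induction m with
  | zero =>
    intro l Z χ P'' hl hnd _ _ _ hP'' _
    have : l = [] := List.eq_nil_of_length_eq_zero (Nat.le_zero.1 hl)
    subst this
    have hdl : ∀ w ∈ P''.toList, ∀ w' ∈ P''.toList, w ≠ w' → Disjoint (esupp (U w)) (esupp (U w')) :=
      fun w hw w' hw' hne => hdP w (hP'' (mem_toList.1 hw)) w' (hP'' (mem_toList.1 hw')) hne
    refine ⟨by simpa using goodChain_of_pairwise_disjoint U hU (P''.nodup_toList) hdl, ?_⟩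
    rw [List.nil_append, (frameIn_eq_self_of_pairwise_disjoint U hU (P''.nodup_toList) hdl).2, toList_toFinset]
    simp
  | succ m ih =>
    intro l Z χ P'' hl hnd hlN hχ hlZ hP'' hcov
    match l, hl, hnd, hlN, hlZ with
    | [], _, _, _, _ => exact ih [] Z χ P'' (by simp) List.nodup_nil (by simp) hχ (by simp) hP'' hcov
    | y :: l', hl, hnd, hlN, hlZ =>
      have hl' : l'.length ≤ m := by simp only [List.length_cons] at hl; omega
      have hnd' : l'.Nodup := (List.nodup_cons.1 hnd).2
      have hyl' : y ∉ l' := (List.nodup_cons.1 hnd).1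
      have hyN : (gann U W y).Nonempty := hlN y List.mem_cons_self
      have hy : y ∈ W := G.hWU y
      have hyZ : y ∉ Z := hlZ y List.mem_cons_self
      obtain ⟨ihc, ihS⟩ := ih l' Z χ P'' hl' hnd' (fun z hz => hlN z (List.mem_cons_of_mem y hz)) hχ
        (fun z hz => hlZ z (List.mem_cons_of_mem y hz)) hP'' hcov
      -- the frame support so far misses the glued block of `y`
      set T : Set ι := (⋃ p ∈ P'', (↑(esupp (U p)) : Set ι)) ∪ ⋃ z ∈ l'.toFinset, (↑(esupp (gframe U W z)) : Set ι) with hTdef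
      have hTy : Disjoint T ↑(esupp (gframe U W y)) := by
        rw [hTdef, Set.disjoint_union_left, Set.disjoint_iUnion₂_left, Set.disjoint_iUnion₂_left]
        refine ⟨fun p hp => ?_, fun z hz => ?_⟩
        · have hp' := mem_filter.1 (hP'' hp)
          have := G.hd p hp'.1 y hy (fun e => hyN.ne_empty (e ▸ hp'.2))
          rw [G.gframe_eq_of_pure hp'.2] at this
          exact disjoint_coe.2 this
        · have hzy : z ≠ y := fun e => hyl' (e ▸ List.mem_toFinset.1 hz)
          exact disjoint_coe.2 (G.hd z (G.hWU z) y hy hzy)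
      -- multi-cross for the witness tuple extended by a point of `gann y`
      have hmc : ∀ ψ ∈ gann U W y,
          2 ≤ ((W.filter fun p => gann U W p = ∅).filter fun p => ∀ z ∈ insert y Z, update χ y ψ z ∉ U p).card := by
        intro ψ hψ
        refine G.two_le_card_multiCross' hE0 (insert_nonempty y Z) fun z hz => ?_
        rcases mem_insert.1 hz with rfl | hz
        · rw [update_self]; exact hψ
        · rw [update_of_ne (ne_of_mem_of_not_mem hz hyZ)]; exact hχ z hz
      -- the pure members counted there lie in `P''` and fail at `ψ`
      have hmcP : ∀ ψ ∈ gann U W y, ∀ p ∈ ((W.filter fun p => gann U W p = ∅).filter fun p => ∀ z ∈ insert y Z, update χ y ψ z ∉ U p),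
          p ∈ P'' ∧ ψ ∉ U p := by
        intro ψ _ p hp
        rw [mem_filter] at hp
        refine ⟨hcov p hp.1 fun z hz => ?_, ?_⟩
        · have := hp.2 z (mem_insert_of_mem hz); rwa [update_of_ne (ne_of_mem_of_not_mem hz hyZ)] at this
        · have := hp.2 y (mem_insert_self y Z); rwa [update_self] at this
      have hcovy : ∀ ψ ∈ gann U W y, ∃ p, ψ ∉ U p ∧ ↑(esupp (U p)) ⊆ T := by
        intro ψ hψ
        obtain ⟨p, hp⟩ := card_pos.1 (lt_of_lt_of_le (by norm_num) (hmc ψ hψ))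
        obtain ⟨hpP, hψp⟩ := hmcP ψ hψ p hp
        exact ⟨p, hψp, fun x hx => Or.inl (Set.mem_biUnion hpP hx)⟩
      have hframe : hull T (U y) = gframe U W y := (gframe_eq_hull_of_cover U W hU G.hne hTy hcovy).symm
      have hfs : frameSupp U (l' ++ P''.toList) = T := ihS
      refine ⟨?_, ?_⟩
      · show GoodChain U (y :: (l' ++ P''.toList))
        rw [goodChain_cons]
        refine ⟨ihc, ?_, ?_⟩
        · simp only [List.mem_append, mem_toList, not_or]
          exact ⟨hyl', fun h => hyN.ne_empty (mem_filter.1 (hP'' h)).2⟩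
        intro φ hφ
        rw [hfs, hframe] at hφ
        rw [mem_safe]
        have hPφ : ∀ p ∈ ((W.filter fun p => gann U W p = ∅).filter fun p => ∀ z ∈ insert y Z, update χ y φ z ∉ U p),
            p ∈ failSet U (l' ++ P''.toList).toFinset φ := by
          intro p hp
          obtain ⟨hpP, hφp⟩ := hmcP φ hφ p hp
          exact (mem_failSet U).2 ⟨by simp [hpP], hφp⟩
        refine ⟨(hmc φ hφ).trans (card_le_card hPφ), fun R hFR hRL => ?_⟩
        -- the robustness set `R`: a sub-list of `l'` over `P''' := R ∩ P''`, witnesses `Z + y`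
        set l'' := l'.filter (fun z => z ∈ R) with hl''def
        set P''' := P''.filter (fun p => p ∈ R) with hP'''def
        have hlen : l''.length ≤ m := (List.length_filter_le _ _).trans hl'
        have hmem'' : ∀ z, z ∈ l'' ↔ z ∈ l' ∧ z ∈ R := fun z => by simp [hl''def]
        obtain ⟨hc'', -⟩ := ih l'' (insert y Z) (update χ y φ) P''' hlen (hnd'.filter _)
          (fun z hz => hlN z (List.mem_cons_of_mem y ((hmem'' z).1 hz).1))
          (fun z hz => by
            rcases mem_insert.1 hz with rfl | hz
            · rw [update_self]; exact hφ
            · rw [update_of_ne (ne_of_mem_of_not_mem hz hyZ)]; exact hχ z hz)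
          (fun z hz hzZ => by
            rcases mem_insert.1 hzZ with e | hzZ
            · subst e; exact hyl' ((hmem'' _).1 hz).1
            · exact hlZ z (List.mem_cons_of_mem y ((hmem'' z).1 hz).1) hzZ)
          (fun p hp => hP'' (mem_filter.1 hp).1)
          (fun p hp hpχ => mem_filter.2 ⟨(hmcP φ hφ p (mem_filter.2 ⟨hp, hpχ⟩)).1, hFR (hPφ p (mem_filter.2 ⟨hp, hpχ⟩))⟩)
        refine ⟨l'' ++ P'''.toList, ?_, hc''⟩
        ext z
        simp only [List.toFinset_append, mem_union, List.mem_toFinset, hmem'', toList_toFinset, hP'''def, mem_filter]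
        constructor
        · rintro (⟨-, hz⟩ | ⟨-, hz⟩) <;> exact hz
        · intro hzR
          have hzL := hRL hzR
          simp only [List.toFinset_append, mem_union, List.mem_toFinset, toList_toFinset] at hzL
          rcases hzL with hz | hz
          · exact Or.inl ⟨hz, hzR⟩
          · exact Or.inr ⟨hz, hzR⟩
      · show frameSupp U (y :: (l' ++ P''.toList)) = _
        rw [frameSupp_cons, frameIn_cons_self, hfs, hframe, List.toFinset_cons]
        ext x
        simp only [Set.mem_union, Set.mem_iUnion, mem_insert, exists_prop, hTdef]
        constructor
        · rintro ((h | ⟨z, hz, hx⟩) | h)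
          · exact Or.inl h
          · exact Or.inr ⟨z, Or.inr hz, hx⟩
          · exact Or.inr ⟨y, Or.inl rfl, h⟩
        · rintro (h | ⟨z, hz | hz, hx⟩)
          · exact Or.inl (Or.inl h)
          · subst hz; exact Or.inr hx
          · exact Or.inl (Or.inr ⟨z, hz, hx⟩)

/-- **`P ∪ N′` is structured for every set `N′` of non-pure members** (from the multi-cross lemma; some coordinate core-free).  With `N′ = N`
this says: the whole family is structured (FVT at every order). [this work] -/
theorem structured_pures_union (hE0 : ∃ f, CoreFree U f) {N' : Finset κ} (hN' : ∀ y ∈ N', (gann U W y).Nonempty) :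
    Structured U ((W.filter fun p => gann U W p = ∅) ∪ N') := by
  obtain ⟨hc, -⟩ := G.goodChain_append_pures hE0 N'.toList.length N'.toList ∅ (fun _ => ∅) (W.filter fun p => gann U W p = ∅)
    le_rfl (N'.nodup_toList) (fun y hy => hN' y (mem_toList.1 hy)) (by simp) (by simp) subset_rfl (fun p hp _ => hp)
  refine ⟨N'.toList ++ (W.filter fun p => gann U W p = ∅).toList, ?_, hc⟩
  rw [List.toFinset_append, toList_toFinset, toList_toFinset, union_comm]

/-- **Some deletion is structured**: "no structured deletion" is contradictory (non-empty family, some coordinate core-free). [this work] -/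
theorem false_of_no_structured_deletion (hE0 : ∃ f, CoreFree U f) (hW : W.Nonempty) (hdel : ∀ x ∈ W, ¬ Structured U (W.erase x)) :
    False := by
  have hU := G.hU
  set P := W.filter fun p => gann U W p = ∅ with hPdef
  set N := W.filter fun p : κ => gann U W p ≠ ∅ with hNdef
  rcases N.eq_empty_or_nonempty with hN0 | ⟨w, hw⟩
  · obtain ⟨x, hx⟩ := hW
    have hallP : ∀ y ∈ W, y ∈ P := by
      intro y hy
      rw [hPdef, mem_filter]
      refine ⟨hy, ?_⟩
      by_contra h
      have : y ∈ N := mem_filter.2 ⟨hy, h⟩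
      rw [hN0] at this; exact notMem_empty _ this
    exact hdel x hx (structured_of_pairwise_disjoint U hU fun y hy y' hy' hne =>
      G.pures_pairwise_disjoint y (hallP y (mem_of_mem_erase hy)) y' (hallP y' (mem_of_mem_erase hy')) hne)
  · have hwN : gann U W w ≠ ∅ := (mem_filter.1 hw).2
    have hst := G.structured_pures_union hE0 (N' := N.erase w)
      (fun y hy => Set.nonempty_iff_ne_empty.2 (mem_filter.1 (mem_of_mem_erase hy)).2)
    apply hdel w (mem_filter.1 hw).1
    convert hst using 1
    ext x
    rw [mem_union, mem_erase_iff_of_nonpure (U := U) (W := W) hwN x]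

end GluedSetting

/-! ### Every order -/

/-- **THE LOCAL-TO-GLOBAL STEP AT EVERY ORDER**: `LocalToGlobal n` holds for every `n`. [this work] -/
theorem localToGlobal_all (n : ℕ) : LocalToGlobal n := by
  intro ι _ U hU hne hns hS hd hF hE0 hι habs hdel
  have hd' : ∀ x ∈ (univ : Finset (Fin (n + 4))), ∀ x' ∈ (univ : Finset (Fin (n + 4))), x ≠ x' →
      Disjoint (esupp (gframe U univ x)) (esupp (gframe U univ x')) := fun x _ x' _ h => hd x x' h
  have G : GluedSetting U univ :=
    { hU := hU, hne := hne, hWU := mem_univ, hS := hS, hd := hd', hι := hι,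
      hF := fun f hf => ⟨hF f hf, faceFConsistent_of_noAbsorber U univ hU hne hns hS hd'
        (fun l _ => by obtain ⟨m, hm, h⟩ := habs l; exact ⟨m, mem_univ m, hm, h⟩) (by simp) hf (hF f hf)⟩ }
  exact G.false_of_no_structured_deletion hE0 ⟨0, mem_univ 0⟩ fun x _ hs => hdel x (by convert hs using 2)

/-- **(TT_k) at every order `k ≥ 4`: terminal families are tight.** [this work] -/
theorem terminalTight_all (n : ℕ) : TerminalTight (n + 1) := terminalTight_of_localToGlobal n (localToGlobal_all n)

/-- **THE IDENTICALLY-ZERO MASTER CONJECTURE AT EVERY ORDER.**  For every `k` and all increasing events `U₁,…,U_k` on a finite product of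
two-point spaces, `E_k(μ_p; 1_{U₁},…,1_{U_k}) = 0` for every `p` in the open cube iff `(U₁,…,U_k) ∈ Z_k` (the recursive zero-flag class).
[this work] -/
theorem masterFamilyIdentEqIff_all : ∀ k, MasterFamilyIdentEqIff k :=
  masterFamilyIdentEqIff_all_of_localToGlobal localToGlobal_all

end GluedFrames

end Summit.CriticalPhenomena.PercolationContinuityZ3.Theorems
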